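/-
Copyright (c) 2026 the pub-hodgecm-mathlib formalisation cell (harness21).  Prover seat hodgecm-mathlib-LH7-p06 (g2) (LH7 hand lent to L1; LEAD F0P6-plan (g14) BATCH #166 (2);
desk K2E3-p14 (g9)), Track B «K2-LIT» ∕ hLiu418 = stmt-HodgeConjecture-24832: U1-CT-ind stage 3 («U1-glob»), brick B2b LEVEL 2, the `hN₃` producer — GROUP-ABSTRACT HALF:
the TWISTED rank-one stage of a family dies at the centre `s = ½` as soon as its THIRD (untwisted, normalised) stage does, over the Γ-factor evaluation letter of W-FE-2b∕2c.
THEOREMS ONLY (no `def`∕`instance`∕notation∕`sorry`).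
-/
import Summits.HodgeConjecture.HodgeConjecture.Theorems.K2LiuRankOneWhittakerFECentre   -- ★ W-FE-3 (K2E3-p06 (g6)): `twistedHeadSum_half_eq_zero_of_normalised_half_eq_zero`; brings ★ W-FE-1b, ★ (K1a-3)-S, ★ B7-S, ★ B3, ★ F1
import HarnessLib

/-!
# Crux `HLiu418`, organ U1-CT-ind STAGE 3 («U1-glob»), brick B2b LEVEL 2 — THE `hN₃` PRODUCER, GROUP-ABSTRACT HALF:
# «the third normalised stage of the family dies at `½`» ⟹ «the ψ_σ-TWISTED STAGE of the family dies at `½`», at EVERY point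
# [CasselmanShalika1980 §2–§4; Casselman1980 §3 Thm. 3.1; KudlaSweet1997 §1; KudlaRallis1994 §2; GanTakeda2011SiegelWeil §7 Lemma 7.4]

Cell `hodgecm-mathlib`, crux item hLiu418 = `stmt-HodgeConjecture-24832`; squad K2, strike line L1, LEAD F0P6-plan (g14) BATCH #166 (2); desk K2E3-p14 (g9); box K2Liu-audit1 (g2);
prover LH7-p06 (g2).  Lane `--supports stmt-HodgeConjecture-24832 --as helper` (count-neutral).

THE SLOT.  ★ LEVEL 1 `K2LiuLocalKernelResidueVanishesOfPlaceLetters.resGen_eq_zero_of_kind_letters_placeLetters` (K2E3-p14) takes, per corner, the TWISTED two-step stage family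
`N₃` of the structured local reading ★ `K2LiuSingularWhittakerLocalReading.exists_twoStep_reading_of_forall_eq` (conjunct (iv): `N₃ s h = ∫ conj ψ(σx)·N₂ s (φ(w₂)φ(u(ι(x)δ))h) dμ_F`
on `1 < re s`, `q_v^{-s}`-rational and regular everywhere) with **`hN₃ : N₃ (½, ·) = 0`**.  This file is the GROUP-ABSTRACT kernel transfer that produces it; the `U(2,2)_v`
instantiation on ★ p862989's witnesses (the Siegel face over THE SAME `N₂`, U1's finite clause, the Bruhat word `κ = d⁻¹`) is FILE B `K2LiuLocalKernelN3Reading`.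

THE THEOREM (`twistedStage_half_eq_zero`).  Letters of ★ W-FE-3 ∕ ★ (K1a-3)-S VERBATIM: a family `Φ : ℂ → G → ℂ`, right-`K′`-invariant (`K′` open) and satisfying the `SL₂`
relation `hrel` with datum `(C₀(s), ν, e(s) = a s + c)` on `1 < re s` (`ν` unitary of conductor letter `cν`), the unipotent letters `u ū hu hu0 hū hū0 hu_add w₀`, the Bruhat
word `ū(r)·w₀u(x′) = w₀u(x′ + κr)` (`κ ≠ 0`), the tail kernel `T_s(x) = C₀(s) ν(x)⁻¹ ‖x‖^{−e(s)}`, an additive character `ψ` of conductor exponent `cψ` and `σ ≠ 0`; then BY VALUE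
  (N)  the TWISTED STAGE   `∫ conj ψ(σx) Φ_s(w₀u(x)g) dμ(x) = N s g`                 on `1 < re s`  (★ (K1a-3)-S `exists_twisted_family`, ★ p862989 (iv)),
  (NC) the THIRD STAGE     `∫ Φ_s(w₀u(x)g) dμ(x) = L(e(s) − 1, ν) · NC s g`           on `1 < re s`  (★ B7-S-all `exists_normalised_family_allS0` (ii)),
all of `s ↦ Φ_s(g)`, `s ↦ N s g`, `s ↦ NC s g` rational in `q₀^{-s}` and regular at `½`, and the Γ-LETTER BY NAME-SHAPE WITH A THRESHOLD
  (Γ)  `∫_{x ∉ 𝔭^M} T_s(x) ψ(σκx⁻¹) dμ(x) = L(e(s) − 1, ν) · Γ̃(s)` for EVERY `M ≥ N₀` and `1 < re s`, `Γ̃` regular at `½`, `Γ̃(½) ≠ 0`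
(discharged for unramified `ν` by ★ W-FE-2b `K2LiuTwistedGammaFactorLetter`, for ramified `ν` by W-FE-2c `K2LiuTwistedGammaFactorRamified` — one `Γ̃` serves every point `g`,
because past the threshold the tail integral does not depend on `M`):
  **`(∀ g, NC (½) g = 0) → ∀ g, N (½) g = 0`.**
PROOF.  Fix `g`.  Take a level `m₀` at `g` (★ B3 `exists_level₂`) and ONE coset level `m` past the five thresholds — HEAD `cψ − jσ` (`‖σ‖ = q^{−jσ}`), TAIL
`jσ − cψ + 2m₀ + 1`, `−m ≤ j := cψ − jσ − 1`, CONDUCTOR `cν − j − 1`, and Γ's `N₀ − kκ − 1` (`‖κ‖ = q^{−kκ}`) — with representatives `R` of `𝔭^{−m} ⧸ 𝔭^{m}`.  ★ W-FE-3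
`twistedHeadSum_half_eq_zero_of_normalised_half_eq_zero` (its `M := m`, normalised family `:= NC`) kills the twisted head sum `Σ_{a∈R} μ(𝔭^m) conj ψ(σa) Φ_{½}(w₀u(a)g)`;
★ (K1a-3)-S `integrable_and_integral_eq_twisted` identifies `N s g` with that head sum on `1 < re s`; both sides are regular at `½`, so ★ F1 `eq_of_eqOn_halfPlane` carries
the identity to `½`: `N(½) g = 0`.
References: [CasselmanShalika1980] W. Casselman, J. Shalika, Compositio Math. 41 (1980), §2–§4; [Casselman1980] W. Casselman, Compositio Math. 40 (1980), §3 Thm. 3.1;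
[KudlaSweet1997] S. Kudla, W. J. Sweet, Israel J. Math. 98 (1997), §1; [KudlaRallis1994] S. Kudla, S. Rallis, Ann. of Math. 140 (1994), §2;
[GanTakeda2011SiegelWeil] W. T. Gan, S. Takeda (2011), §7 Lemma 7.4; [Tate1950] J. Tate, thesis (1950), §2.5.
HONEST LABEL.  Count-neutral helper: `HC_CM` is proved only modulo the 7 printed citations (2 remaining named inputs: hLiu418 = `stmt-HodgeConjecture-24832`,
h413 = `stmt-HodgeConjecture-24833`) until rung 0 closes; this file closes no socket — it is consumed by FILE B, whose output is LEVEL 1's `hN₃`.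
-/

set_option autoImplicit false
set_option linter.dupNamespace false -- the mandated namespace repeats `HodgeConjecture.HodgeConjecture`

noncomputable section

open MeasureTheory Filter Topology Set
open scoped NNReal ENNReal ComplexConjugate
open NumberField IsDedekindDomain
open Literature.NumberTheory.GaloisRepresentations.IsNonarchimedeanLocalField
open Literature.NumberTheory.Automorphic Literature.NumberTheory.Automorphic.LocalFieldHaar
open Summit.HodgeConjecture.HodgeConjecture.Cruxes.HLiu418.K2LiuQRationalDefs
open Summit.HodgeConjecture.HodgeConjecture.Cruxes.HLiu418.K2LiuLocalLFactorDefs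
open Summit.HodgeConjecture.HodgeConjecture.Cruxes.HLiu418.K2LiuRankOneOperators (exists_level₂)
open Summit.HodgeConjecture.HodgeConjecture.Cruxes.HLiu418.K2LiuRankOneStage (integrable_of_letters)
open Summit.HodgeConjecture.HodgeConjecture.Cruxes.HLiu418.K2LiuRankOneStageTwisted (integrable_and_integral_eq_twisted)
open Summit.HodgeConjecture.HodgeConjecture.Cruxes.HLiu418.K2LiuRankOneWhittakerFECentre (twistedHeadSum_half_eq_zero_of_normalised_half_eq_zero)

namespace Summit.HodgeConjecture.HodgeConjecture.Cruxes.HLiu418.K2LiuLocalKernelN3OfGammaLetter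

variable {K : Type} [Field K] [NumberField K] {w : HeightOneSpectrum (𝓞 K)} {G : Type*} [Group G] [TopologicalSpace G] [IsTopologicalGroup G]
variable [MeasurableSpace (w.adicCompletion K)] [BorelSpace (w.adicCompletion K)] (μ : Measure (w.adicCompletion K)) [μ.IsAddHaarMeasure]

/-- **KERNEL TRANSFER AT THE CENTRE, THIRD STAGE ⟹ TWISTED STAGE, AT EVERY POINT.**  For a family `Φ` in the letters of ★ W-FE-3 ∕ ★ (K1a-3)-S (right-`K′`-invariance,
the `SL₂` relation `hrel` with `(C₀(s), ν, e(s) = a s + c)` on `1 < re s`, the Bruhat word `ū(r)·w₀u(x′) = w₀u(x′ + κr)`, the tail kernel `T`, the conductor letter `cν` of `ν`,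
`ψ` of conductor exponent `cψ`, `σ ≠ 0`), its twisted stage `N` and third normalised stage `NC` BY VALUE on `1 < re s`, all regular at `½`, and a Γ-letter
`∫_{x∉𝔭^M} T_s(x)ψ(σκx⁻¹) = L(e(s)−1,ν)·Γ̃(s)` past a threshold `N₀` with `Γ̃` regular and non-zero at `½`:
**`NC(½, ·) = 0 ⟹ N(½, ·) = 0`.** [cite: CasselmanShalika1980, §4] [cite: Casselman1980, §3 Thm. 3.1] [cite: KudlaSweet1997, §1] [cite: GanTakeda2011SiegelWeil, §7 Lemma 7.4] -/
theorem twistedStage_half_eq_zero (Φ : ℂ → G → ℂ) {K' : Subgroup G} (hK' : IsOpen (K' : Set G))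
    (hΦK : ∀ s : ℂ, 1 < s.re → ∀ g, ∀ k ∈ K', Φ s (g * k) = Φ s g)
    {u ū : w.adicCompletion K → G} (hu : Continuous u) (hu0 : u 0 = 1) (hū : Continuous ū) (hū0 : ū 0 = 1) (hu_add : ∀ x t, u (x + t) = u x * u t) (w₀ : G)
    (ν : (w.adicCompletion K)ˣ →* ℂˣ) (hν : ∀ x, ‖((ν x : ℂˣ) : ℂ)‖ = 1) (ae : ℕ) (ce : ℂ) (he : ∀ s : ℂ, 1 < s.re → 1 < ((ae : ℂ) * s + ce).re)
    (C₀ : ℂ → ℂ)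
    (hrel : ∀ s : ℂ, 1 < s.re → ∀ (x : (w.adicCompletion K)ˣ) (g : G),
      Φ s (w₀ * u x * g) = C₀ s * (((ν x)⁻¹ : ℂˣ) : ℂ) * ((normAbs (w.adicCompletion K) (x : w.adicCompletion K) : ℝ) : ℂ) ^ (-((ae : ℂ) * s + ce)) *
        Φ s (ū ((x⁻¹ : (w.adicCompletion K)ˣ) : w.adicCompletion K) * g))
    {κ : w.adicCompletion K} (hκ0 : κ ≠ 0) (hword : ∀ r x' : w.adicCompletion K, ū r * (w₀ * u x') = w₀ * u (x' + κ * r))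
    (T : ℂ → w.adicCompletion K → ℂ)
    (hT : ∀ (s : ℂ) (x : (w.adicCompletion K)ˣ), T s x = C₀ s * (((ν x)⁻¹ : ℂˣ) : ℂ) * ((normAbs (w.adicCompletion K) (x : w.adicCompletion K) : ℝ) : ℂ) ^ (-((ae : ℂ) * s + ce)))
    (cν : ℤ)
    (hνc : ∀ x : (w.adicCompletion K)ˣ, normAbs (w.adicCompletion K) (x : w.adicCompletion K) = 1 →
      (x : w.adicCompletion K) - 1 ∈ primePowBall (w.adicCompletion K) cν → ν x = 1)
    {ψ : AddChar (w.adicCompletion K) Circle} {cψ : ℤ} (hcψ : ψ.HasConductorExp cψ) {σ : w.adicCompletion K} (hσ : σ ≠ 0)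
    (N : ℂ → G → ℂ) (hN : ∀ s : ℂ, 1 < s.re → ∀ g, ∫ x, conj ((ψ (σ * x) : ℂ)) * Φ s (w₀ * u x * g) ∂μ = N s g)
    (NC : ℂ → G → ℂ) (hNC : ∀ s : ℂ, 1 < s.re → ∀ g, ∫ x, Φ s (w₀ * u x * g) ∂μ = lFactor K w ν ((ae : ℂ) * s + ce - 1) * NC s g)
    {q₀ : ℕ} (hq₀ : 2 ≤ q₀)
    (hΦreg : ∀ g, IsQRationalRegularAt q₀ (1 / 2) fun s => Φ s g)
    (hNreg : ∀ g, IsQRationalRegularAt q₀ (1 / 2) fun s => N s g)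
    (hNCreg : ∀ g, IsQRationalRegularAt q₀ (1 / 2) fun s => NC s g)
    (Γt : ℂ → ℂ) (N₀ : ℤ)
    (hΓ : ∀ M : ℤ, N₀ ≤ M → ∀ s : ℂ, 1 < s.re →
      ∫ x in (primePowBall (w.adicCompletion K) M)ᶜ, T s x * ((ψ (σ * (κ * x⁻¹)) : ℂ)) ∂μ = lFactor K w ν ((ae : ℂ) * s + ce - 1) * Γt s)
    (hΓreg : IsQRationalRegularAt q₀ (1 / 2) Γt) (hΓ0 : Γt (1 / 2) ≠ 0)
    (hNC0 : ∀ g, NC (1 / 2) g = 0) (y : G) :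
    N (1 / 2) y = 0 := by
  have hq0 : (0 : ℝ≥0) < (residueFieldCard (w.adicCompletion K) : ℝ≥0)⁻¹ := inv_residueFieldCard_pos
  -- `‖σ‖ = q^{−jσ}`, `‖κ‖ = q^{−kκ}`; a level `m₀` at `y`
  obtain ⟨jσ, hjσ⟩ := exists_normAbs_eq_inv_zpow hσ
  obtain ⟨kκ, hκ⟩ := exists_normAbs_eq_inv_zpow hκ0
  obtain ⟨m₀, hmu, hmū⟩ := exists_level₂ u ū hu hu0 hū hū0 K' hK' y
  -- ONE coset level past the five thresholds: HEAD, TAIL, `−m ≤ j` (`j := cψ − jσ − 1`), CONDUCTOR, Γ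
  obtain ⟨m, hm₀m, hmhead, hmtail, hmj, hmc, hmΓ⟩ : ∃ m : ℕ, m₀ ≤ m ∧ cψ - jσ ≤ (m : ℤ) ∧ jσ - cψ + 2 * (m₀ : ℤ) + 1 ≤ (m : ℤ) ∧
      jσ + 1 - cψ ≤ (m : ℤ) ∧ cν - cψ + jσ ≤ (m : ℤ) ∧ N₀ - kκ - 1 ≤ (m : ℤ) := by
    have h₁ := Int.self_le_toNat (cψ - jσ)
    have h₂ := Int.self_le_toNat (jσ - cψ + 2 * (m₀ : ℤ) + 1)
    have h₃ := Int.self_le_toNat (jσ + 1 - cψ)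
    have h₄ := Int.self_le_toNat (cν - cψ + jσ)
    have h₅ := Int.self_le_toNat (N₀ - kκ - 1)
    refine ⟨m₀ + (cψ - jσ).toNat + (jσ - cψ + 2 * (m₀ : ℤ) + 1).toNat + (jσ + 1 - cψ).toNat + (cν - cψ + jσ).toNat + (N₀ - kκ - 1).toNat,
      by omega, ?_, ?_, ?_, ?_, ?_⟩ <;> push_cast <;> omega
  -- HEAD: `ψ(σ·) = 1` on `𝔭^m`; TAIL: `ψ(σ·)` non-trivial somewhere on `𝔭^{2m₀−m}`; `σ ∉ 𝔭^{cψ − j}`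
  have hσm : ∀ t ∈ primePowBall (w.adicCompletion K) (m : ℤ), ψ (σ * t) = 1 := fun t ht =>
    hcψ.1 _ ((mul_mem_primePowBall_iff hjσ).2 (primePowBall_antitone (by linarith) ht))
  have htail : ∃ t₀ ∈ primePowBall (w.adicCompletion K) (2 * (m₀ : ℤ) - m), ψ (σ * t₀) ≠ 1 := by
    have hσout : σ ∉ primePowBall (w.adicCompletion K) (cψ - (2 * (m₀ : ℤ) - m)) := by
      rw [mem_primePowBall_iff, hjσ, not_le]
      exact (zpow_lt_zpow_iff_right_of_lt_one₀ hq0 inv_residueFieldCard_lt_one).2 (by linarith)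
    obtain ⟨t₀, ht₀, hne⟩ := exists_mem_primePowBall_addChar_mul_ne_one hcψ hσout
    exact ⟨t₀, ht₀, by rwa [mul_comm] at hne⟩
  have hσj : σ ∉ primePowBall (w.adicCompletion K) (cψ - (cψ - jσ - 1)) := by
    rw [mem_primePowBall_iff, hjσ, not_le]
    exact (zpow_lt_zpow_iff_right_of_lt_one₀ hq0 inv_residueFieldCard_lt_one).2 (by linarith)
  -- representatives of `𝔭^{−m} ⧸ 𝔭^{m}`; integrability along `w₀u(·)g` on the half-plane (★ B7-S)
  obtain ⟨R, -, hRinc, hRcov⟩ := exists_finset_primePowBall_eq_biUnion (F := w.adicCompletion K) (j := -(m : ℤ)) (r := (m : ℤ)) (by omega)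
  have hint : ∀ s : ℂ, 1 < s.re → ∀ g, Integrable (fun x => Φ s (w₀ * u x * g)) μ := fun s hs g =>
    integrable_of_letters μ hK' (hΦK s hs) hu hu0 hū hū0 hu_add w₀ ν hν _ (C₀ s) (he s hs) (hrel s hs) g
  -- ★ W-FE-3 (`M := m`, normalised family `NC`): the twisted head sum of `Φ_{½}` dies
  have hsum : ∑ a ∈ R, (μ.real (primePowBall (w.adicCompletion K) (m : ℤ)) : ℂ) * (conj ((ψ (σ * a) : ℂ)) * Φ (1 / 2) (w₀ * u a * y)) = 0 :=
    twistedHeadSum_half_eq_zero_of_normalised_half_eq_zero μ Φ hΦK hu_add w₀ ν hν ae ce he C₀ hrel κ hκ hword T hT cν hνc y m₀ hmu hmū hcψ hσj m hm₀m hσm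
      (M := (m : ℤ)) (by exact_mod_cast hm₀m) (by linarith) (by linarith) R hRinc hRcov (fun s hs a _ => hint s hs (w₀ * u a * y)) NC hNC hq₀
      (fun a _ => hNCreg (w₀ * u a * y)) (fun a _ => hΦreg (w₀ * u a * y)) Γt (hΓ ((m : ℤ) + kκ + 1) (by linarith)) hΓreg hΓ0 fun a _ => hNC0 _
  -- ★ (K1a-3)-S: on the half-plane the twisted stage IS that head sum
  have hcoset : ∀ s : ℂ, 1 < s.re →
      N s y = ∑ a ∈ R, (μ.real (primePowBall (w.adicCompletion K) (m : ℤ)) : ℂ) * (conj ((ψ (σ * a) : ℂ)) * Φ s (w₀ * u a * y)) := fun s hs => by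
    rw [← hN s hs y]
    exact (integrable_and_integral_eq_twisted μ (hΦK s hs) hu_add w₀ ν _ (C₀ s) (hrel s hs) ψ σ y m₀ m hm₀m hmu hmū (hint s hs y) hσm htail R hRinc hRcov).2
  -- ★ F1: two families regular at `½` that agree on `1 < re s` agree at `½`
  have hreg : IsQRationalRegularAt q₀ (1 / 2) fun s =>
      ∑ a ∈ R, (μ.real (primePowBall (w.adicCompletion K) (m : ℤ)) : ℂ) * (conj ((ψ (σ * a) : ℂ)) * Φ s (w₀ * u a * y)) :=
    IsQRationalRegularAt.sum R (Φ := fun a s => (μ.real (primePowBall (w.adicCompletion K) (m : ℤ)) : ℂ) * (conj ((ψ (σ * a) : ℂ)) * Φ s (w₀ * u a * y)))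
      fun a _ => ((hΦreg (w₀ * u a * y)).const_mul _).const_mul _
  exact ((hNreg y).eq_of_eqOn_halfPlane hq₀ hreg 1 hcoset).trans hsum

end Summit.HodgeConjecture.HodgeConjecture.Cruxes.HLiu418.K2LiuLocalKernelN3OfGammaLetter

end
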